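import Mathlib
import Summits.RiemannHypothesis.RiemannHypothesis.Theorems.WeilFarFloorSecondOrderExactRH
import Summits.RiemannHypothesis.RiemannHypothesis.Theorems.WeilFarFloorCramerLagEnergyMean
import Summits.RiemannHypothesis.RiemannHypothesis.Theorems.WeilFarFloorCramerPrimitiveRH
import Literature.NumberTheory.LFunctions.CramerMeanSquareAsymptoticRH
import Summits.RiemannHypothesis.RiemannHypothesis.Theorems.WeilFarFloorResidualEnergyCramer
import Summits.RiemannHypothesis.RiemannHypothesis.Theorems.WeilFarFloorGapEnergyIntegrable
import Summits.RiemannHypothesis.RiemannHypothesis.Theorems.WeilFarFloorCoshOptimalBudgets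
import HarnessLib

/-!
# THE FLOOR GAP HAS CESÀRO SLOPE `β₂ = Σ_ρ m(ρ)²/|ρ|²` (under RH)

Helper file (`--supports stmt-RiemannHypothesis-0098`, lead-track anchor: Weil-positivity window ladder, format-C far bound),
pure proofs.  Seat rh-explicit-weil-1 gen16 (memo `run/shared/lean/pub/rh-explicit/rh-explicit-weil-1/FORMAT-K3.md` §17).

Inputs: the two-sided second-order law (`WeilFarFloorSecondOrderExactRH`), `J = (e^a/4P)Φ + O(√Φ + 1)`
(`WeilFarFloorResidualEnergyCramer`), `Φ ≤ 4F(2a)` and `(1/A²)∫₁^A Φ → 2β` (`WeilFarFloorCramerLagEnergyMean`, fed with MV 13.6 and the bounded primitive under RH), the integrability of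
the gap energy (`WeilFarFloorGapEnergyIntegrable`).
* §3 the sandwich `|(λ_max − R_c)R_c − Φ/2| ≤ (ε(1+δ) + δ)·Φ/2 + K` eventually, for all `ε, δ > 0`
  (`abs_gapEnergy_sub_half_cramerLagEnergy_le_of_RH`; `2C√j ≤ δj + C²/δ` removes the square root), and
  ★★ `tendsto_cesaro_gapEnergy_of_RH`: **`RH → (1/A²)∫₁^A (λ_max(a) − R_c(a))·R_c(a) da → β₂`** — the floor gap, weighted by
  `R_c(a) ~ e^a`, grows with CESÀRO SLOPE `β₂ = Σ_ρ m(ρ)²/|ρ|²` (`= β_F = 2 + γ − log 4π` if the zeros of `ζ` are simple: the same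
  constant that bounds the C-XIII discrepancy `|λ_max(a) − (L(a) − 2γ)| ≤ β_F + o(1)`), while pointwise the slope stays below `4β₂`.
Standard axioms only; RH enters as Mathlib's `RiemannHypothesis`.  Nothing here bears on the truth of RH.
-/

set_option linter.dupNamespace false
set_option autoImplicit false

noncomputable section

open MeasureTheory Set Filter Topology
open scoped Real BigOperators ArithmeticFunction.vonMangoldt Chebyshev

namespace Summit.RiemannHypothesis.RiemannHypothesis.Theorems.WeilFormatC

namespace FloorResidualMean

open Literature.NumberTheory.LFunctions FloorCosh FloorCoshSplit FloorSecondOrder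

/-! ## The sandwich and the Cesàro mean of the gap energy -/

/-- **THE CESÀRO MEAN OF THE CRAMÉR AUTOCORRELATION ENERGY UNDER RH**: `(1/A²)∫₁^A Φ(b) db → 2β₂`, `β₂ = Σ_ρ m(ρ)²/|ρ|²`
(`WeilFarFloorCramerLagEnergyMean.tendsto_cesaro_cramerLagEnergy` with MV Thm. 13.6 (Literature `CramerMeanSquare`) and the bounded
primitive of `g` (`WeilFarFloorCramerPrimitiveRH`)). -/
theorem tendsto_cesaro_cramerLagEnergy_of_RH (hRH : RiemannHypothesis) :
    Tendsto (fun A : ℝ ↦ 1 / A ^ 2 * ∫ b in (1 : ℝ)..A, ∫ u in (0 : ℝ)..(2 * b),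
        (Real.exp (-(u / 2)) * (ψ (Real.exp u) - Real.exp u)
          + Real.exp (-((2 * b - u) / 2)) * (ψ (Real.exp (2 * b - u)) - Real.exp (2 * b - u))) ^ 2) atTop
      (𝓝 (2 * ∑' ρ : ZetaZeros.riemannZetaNontrivialZeros,
        (riemannZetaZeroOrder (ρ : ℂ) : ℝ) * ((riemannZetaZeroOrder (ρ : ℂ) : ℝ) / ‖(ρ : ℂ)‖ ^ 2))) := by
  obtain ⟨C, hC⟩ := exists_abs_integral_cramerFn_le_of_RH hRH
  exact tendsto_cesaro_cramerLagEnergy (CramerMeanSquare.tendsto_mean_sq_psi_exp_sub_of_RH hRH) hC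

/-- **The sandwich**: under RH, for all `ε, δ > 0` there are `K, a₁` with
`|(λ_max(a) − R_c(a))R_c(a) − Φ(a)/2| ≤ (ε(1+δ) + δ)·Φ(a)/2 + K` for `a ≥ a₁`. -/
theorem abs_gapEnergy_sub_half_cramerLagEnergy_le_of_RH (hRH : RiemannHypothesis) {ε δ : ℝ} (hε : 0 < ε) (hδ : 0 < δ) :
    ∃ K a₁ : ℝ, 0 ≤ K ∧ 1 ≤ a₁ ∧ ∀ a : ℝ, a₁ ≤ a →
      |(farCoercivityFloor a - primeShiftForm a ((Icc (-a) a).indicator (fun y ↦ Real.cosh (y / 2))) / (a + Real.sinh a))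
          * (primeShiftForm a ((Icc (-a) a).indicator (fun y ↦ Real.cosh (y / 2))) / (a + Real.sinh a))
        - (∫ u in (0 : ℝ)..(2 * a), (Real.exp (-(u / 2)) * (ψ (Real.exp u) - Real.exp u)
            + Real.exp (-((2 * a - u) / 2)) * (ψ (Real.exp (2 * a - u)) - Real.exp (2 * a - u))) ^ 2) / 2|
      ≤ (ε * (1 + δ) + δ) * ((∫ u in (0 : ℝ)..(2 * a), (Real.exp (-(u / 2)) * (ψ (Real.exp u) - Real.exp u)
            + Real.exp (-((2 * a - u) / 2)) * (ψ (Real.exp (2 * a - u)) - Real.exp (2 * a - u))) ^ 2) / 2) + K := by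
  set β := ∑' ρ : ZetaZeros.riemannZetaNontrivialZeros,
    (riemannZetaZeroOrder (ρ : ℂ) : ℝ) * ((riemannZetaZeroOrder (ρ : ℂ) : ℝ) / ‖(ρ : ℂ)‖ ^ 2) with hβdef
  have hβ0 : 0 ≤ β := tsum_nonneg fun ρ ↦ by
    have := riemannZetaZeroOrder_nonneg (ZetaZeros.riemannZetaNontrivialZeros.ne_one ρ.2)
    have hm : (0 : ℝ) ≤ riemannZetaZeroOrder (ρ : ℂ) := by exact_mod_cast this
    positivity
  obtain ⟨a₁, hX2⟩ := abs_farCoercivityFloor_sub_coshQuotient_sub_secondOrder_le_of_RH hRH hε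
  obtain ⟨C, b₀, hα⟩ := abs_sqrt_residualEnergy_sub_le_of_RH hRH
  have hC0 : 0 ≤ C := le_trans (abs_nonneg _) (hα b₀ le_rfl)
  obtain ⟨Cq, hCq0, hq⟩ := coshQuotient_ge_of_RH hRH
  have hF := CramerMeanSquare.tendsto_mean_sq_psi_exp_sub_of_RH hRH
  obtain ⟨U₀, hU₀⟩ := eventually_atTop.1 ((Metric.tendsto_nhds.1 hF) 1 one_pos)
  -- smallness of C_q(a³+1)e^{−a}
  have hsmall : Tendsto (fun a : ℝ ↦ Cq * ((a ^ 3 + 1) * Real.exp (-a))) atTop (𝓝 0) := by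
    have h3' : Tendsto (fun a : ℝ ↦ a ^ 3 * Real.exp (-a)) atTop (𝓝 0) := Real.tendsto_pow_mul_exp_neg_atTop_nhds_zero 3
    have h0' : Tendsto (fun a : ℝ ↦ Real.exp (-a)) atTop (𝓝 0) := Real.tendsto_exp_neg_atTop_nhds_zero
    have := ((h3'.add h0').const_mul Cq)
    simp only [mul_zero, add_zero] at this
    exact this.congr fun a ↦ by ring
  obtain ⟨a₃, h4⟩ := eventually_atTop.1 ((Metric.tendsto_nhds.1 hsmall) (1 / 2) (by norm_num))
  set K := (1 + ε) * (C ^ 2 / δ + C ^ 2) + 76 * ε + 16 * (β + 1) with hK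
  have hK0 : 0 ≤ K := by positivity
  refine ⟨K, max (max a₁ b₀) (max (max a₃ 1) U₀), hK0, le_trans (le_max_right a₃ 1) (le_trans (le_max_left _ _) (le_max_right _ _)),
    fun a ha ↦ ?_⟩
  have ha₁ : a₁ ≤ a := le_trans (le_max_left _ _) (le_trans (le_max_left _ _) ha)
  have hb₀ : b₀ ≤ a := le_trans (le_max_right _ _) (le_trans (le_max_left _ _) ha)
  have ha₃ : a₃ ≤ a := le_trans (le_max_left _ _) (le_trans (le_max_left _ _) (le_trans (le_max_right _ _) ha))
  have ha1 : 1 ≤ a := le_trans (le_max_right _ _) (le_trans (le_max_left _ _) (le_trans (le_max_right _ _) ha))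
  have hU : U₀ ≤ a := le_trans (le_max_right _ _) (le_trans (le_max_right _ _) ha)
  have ha0 : 0 ≤ a := by linarith
  -- instantiate before abbreviating
  have hx2 := hX2 a ha₁
  have hal := hα a hb₀
  have hqa := hq a ha1
  have hΦ4 := cramerLagEnergy_le (b := a) ha0
  have h4a := h4 a ha₃
  have hUa := hU₀ (2 * a) (by linarith)
  have htriv := farCoercivityFloor_le_trivial (a := a) (by linarith)
  have hRle := coshQuotient_le_farCoercivityFloor (a := a) (by linarith)
  set P := a + Real.sinh a with hP
  set R := primeShiftForm a ((Icc (-a) a).indicator (fun y ↦ Real.cosh (y / 2))) / P with hR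
  set J := (∫ x in Ioo (-a) a,
      ((∑ n ∈ weilPrimeIndex a, (Λ n : ℝ) / Real.sqrt n *
          ((Icc (-a) a).indicator (fun y ↦ Real.cosh (y / 2)) (x - Real.log n)
            + (Icc (-a) a).indicator (fun y ↦ Real.cosh (y / 2)) (x + Real.log n)))
        - R * (Icc (-a) a).indicator (fun y ↦ Real.cosh (y / 2)) x) ^ 2) / P with hJ
  set Φ := ∫ u in (0 : ℝ)..(2 * a), (Real.exp (-(u / 2)) * (ψ (Real.exp u) - Real.exp u)
      + Real.exp (-((2 * a - u) / 2)) * (ψ (Real.exp (2 * a - u)) - Real.exp (2 * a - u))) ^ 2 with hΦ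
  set F := ∫ u in (0 : ℝ)..(2 * a), Real.exp (-u) * (ψ (Real.exp u) - Real.exp u) ^ 2 with hFdef
  have hP0 : 0 < P := by have := Real.sinh_pos_iff.2 (by linarith : 0 < a); rw [hP]; linarith
  have hE : 0 < Real.exp a := Real.exp_pos a
  have hEa : Real.exp (-a) = (Real.exp a)⁻¹ := Real.exp_neg a
  have hJ0 : 0 ≤ J := div_nonneg (integral_nonneg fun x ↦ sq_nonneg _) hP0.le
  have hΦ0 : 0 ≤ Φ := intervalIntegral.integral_nonneg (by linarith) fun u _ ↦ sq_nonneg _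
  -- R ≥ e^a/2 > 0
  rw [Real.dist_eq, sub_zero, abs_lt] at h4a
  have hRpos : 0 < R := by
    have e1 : Cq * (a ^ 3 + 1) = Cq * ((a ^ 3 + 1) * Real.exp (-a)) * Real.exp a := by rw [hEa]; field_simp
    have e2 : Cq * ((a ^ 3 + 1) * Real.exp (-a)) * Real.exp a ≤ 1 / 2 * Real.exp a :=
      mul_le_mul_of_nonneg_right h4a.2.le hE.le
    linarith
  have hRne : R ≠ 0 := hRpos.ne'
  -- (1) |w − J| ≤ ε(J + e^{−a}R), e^{−a}R ≤ 76
  have hw : |(farCoercivityFloor a - R) * R - J| ≤ ε * (J + Real.exp (-a) * R) := by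
    have e : (farCoercivityFloor a - R) * R - J = (farCoercivityFloor a - R - J / R) * R := by
      rw [sub_mul (farCoercivityFloor a - R), div_mul_cancel₀ _ hRne]
    rw [e, abs_mul, abs_of_pos hRpos]
    have h5 := mul_le_mul_of_nonneg_right hx2 hRpos.le
    have e2 : ε * (J / R + Real.exp (-a)) * R = ε * (J + Real.exp (-a) * R) := by
      rw [mul_assoc, add_mul, div_mul_cancel₀ _ hRne]
    linarith [e2]
  have hR76 : Real.exp (-a) * R ≤ 76 := by
    have h1 : R ≤ 38 * (Real.exp a + 1) := hRle.trans htriv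
    rw [hEa]
    have h2 : (Real.exp a)⁻¹ * R ≤ (Real.exp a)⁻¹ * (38 * (Real.exp a + 1)) :=
      mul_le_mul_of_nonneg_left h1 (inv_pos.2 hE).le
    have h3 : (Real.exp a)⁻¹ * (38 * (Real.exp a + 1)) = 38 + 38 * (Real.exp a)⁻¹ := by field_simp
    have h4 : (Real.exp a)⁻¹ ≤ 1 := inv_le_one_of_one_le₀ (Real.one_le_exp ha0)
    linarith
  -- (2) |J − j| ≤ δ j + C²/δ + C², j = (e^a/4P)Φ, via |√J − √j| ≤ C
  set m := 1 / 2 * Real.sqrt (Real.exp a / P) * Real.sqrt Φ with hm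
  have hm0 : 0 ≤ m := by positivity
  have hPne : P ≠ 0 := hP0.ne'
  have hj : m ^ 2 = Real.exp a / (4 * P) * Φ := by
    rw [hm, mul_pow, mul_pow, Real.sq_sqrt (by positivity), Real.sq_sqrt hΦ0]; field_simp; ring
  have hJj : |J - m ^ 2| ≤ δ * m ^ 2 + C ^ 2 / δ + C ^ 2 := by
    have hs : |Real.sqrt J - m| ≤ C := hal
    have hs2 := (abs_le.1 hs).2
    have hsJ : Real.sqrt J ≤ m + C := by linarith only [hs2]
    have e : J - m ^ 2 = (Real.sqrt J - m) * (Real.sqrt J + m) := by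
      have h := Real.sq_sqrt hJ0
      linear_combination -h
    rw [e, abs_mul, abs_of_nonneg (by positivity : 0 ≤ Real.sqrt J + m)]
    have h1 : |Real.sqrt J - m| * (Real.sqrt J + m) ≤ C * (2 * m + C) :=
      mul_le_mul hs (by linarith only [hsJ]) (by positivity) hC0
    -- 2Cm ≤ δ m² + C²/δ
    have h2 : 2 * C * m ≤ δ * m ^ 2 + C ^ 2 / δ := by
      have h3 : 2 * C * m * δ ≤ δ ^ 2 * m ^ 2 + C ^ 2 := by linarith only [sq_nonneg (δ * m - C)]
      have h4 : δ * m ^ 2 + C ^ 2 / δ = (δ ^ 2 * m ^ 2 + C ^ 2) / δ := by field_simp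
      rw [h4, le_div_iff₀ hδ]; linarith only [h3]
    linarith only [h1, h2]
  -- (3) 0 ≤ Φ/2 − j ≤ 16(β+1)
  have hjΦ : m ^ 2 ≤ Φ / 2 := by
    rw [hj]
    have h12 : Real.exp a / (4 * P) ≤ 1 / 2 := by
      rw [div_le_iff₀ (by positivity)]; linarith [exp_le_two_mul_norm (b := a) (by linarith)]
    have := mul_le_mul_of_nonneg_right h12 hΦ0
    linarith
  have hΦj : Φ / 2 - m ^ 2 ≤ 16 * (β + 1) := by
    rw [hj]
    -- Φ/2 − (e^a/4P)Φ = ((2P − e^a)/(4P))Φ = ((2a − e^{−a})/(4P))Φ ≤ (a/(2P))·Φ ≤ (a/(2P))·8(β+1)a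
    have hFle : F ≤ (β + 1) * (2 * a) := by
      rw [Real.dist_eq] at hUa
      have h2a : 0 < 2 * a := by linarith
      have h1 : 1 / (2 * a) * F ≤ β + 1 := by linarith [(abs_lt.1 hUa).2]
      have h3 := mul_le_mul_of_nonneg_left h1 h2a.le
      rw [← mul_assoc, mul_one_div_cancel h2a.ne', one_mul] at h3
      linarith
    have hΦle : Φ ≤ 8 * (β + 1) * a := by linarith
    have e : Φ / 2 - Real.exp a / (4 * P) * Φ = (2 * P - Real.exp a) / (4 * P) * Φ := by field_simp; ring
    rw [e]
    have h2P : 2 * P - Real.exp a ≤ 2 * a := by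
      rw [hP, Real.sinh_eq]; have := Real.exp_pos (-a); linarith
    have hsq := sq_div_norm_le_four ha0
    have hdiv : a ^ 2 / P ≤ 4 := by rw [div_le_iff₀ hP0]; linarith
    calc (2 * P - Real.exp a) / (4 * P) * Φ ≤ (2 * a) / (4 * P) * (8 * (β + 1) * a) := by
          apply mul_le_mul (div_le_div_of_nonneg_right h2P (by positivity)) hΦle hΦ0 (by positivity)
      _ = 4 * (β + 1) * (a ^ 2 / P) := by field_simp; ring
      _ ≤ 4 * (β + 1) * 4 := mul_le_mul_of_nonneg_left hdiv (by positivity)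
      _ = 16 * (β + 1) := by ring
  -- assemble
  have hδm := mul_le_mul_of_nonneg_left hjΦ hδ.le
  have hJle : J ≤ (1 + δ) * (Φ / 2) + C ^ 2 / δ + C ^ 2 := by
    have := (abs_le.1 hJj).2; linarith only [this, hδm, hjΦ]
  have hwJ : |(farCoercivityFloor a - R) * R - J| ≤ ε * (1 + δ) * (Φ / 2) + ε * (C ^ 2 / δ + C ^ 2 + 76) := by
    calc |(farCoercivityFloor a - R) * R - J| ≤ ε * (J + Real.exp (-a) * R) := hw
      _ ≤ ε * ((1 + δ) * (Φ / 2) + C ^ 2 / δ + C ^ 2 + 76) :=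
          mul_le_mul_of_nonneg_left (by linarith only [hJle, hR76]) hε.le
      _ = _ := by ring
  have hJΦ : |J - Φ / 2| ≤ δ * (Φ / 2) + C ^ 2 / δ + C ^ 2 + 16 * (β + 1) := by
    have h1 := abs_le.1 hJj
    have hm2 : 0 ≤ δ * m ^ 2 := by positivity
    rw [abs_le]; constructor <;> linarith only [h1.1, h1.2, hΦj, hjΦ, hδm, hm2]
  calc |(farCoercivityFloor a - R) * R - Φ / 2|
      ≤ |(farCoercivityFloor a - R) * R - J| + |J - Φ / 2| := abs_sub_le _ _ _
    _ ≤ ε * (1 + δ) * (Φ / 2) + ε * (C ^ 2 / δ + C ^ 2 + 76) + (δ * (Φ / 2) + C ^ 2 / δ + C ^ 2 + 16 * (β + 1)) :=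
        add_le_add hwJ hJΦ
    _ = (ε * (1 + δ) + δ) * (Φ / 2) + K := by rw [hK]; ring

/-- **THE FLOOR GAP HAS CESÀRO SLOPE `β₂`** (under RH):
`(1/A²)∫₁^A (λ_max(a) − R_c(a))·R_c(a) da → β₂ = Σ_ρ m(ρ)²/|ρ|²` — the gap energy inherits the Cesàro mean of the Cramér
autocorrelation energy (`WeilFarFloorCramerLagEnergyMean`) through the second-order law and the sandwich above. -/
theorem tendsto_cesaro_gapEnergy_of_RH (hRH : RiemannHypothesis) :
    Tendsto (fun A : ℝ ↦ 1 / A ^ 2 * ∫ a in (1 : ℝ)..A,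
        (farCoercivityFloor a - primeShiftForm a ((Icc (-a) a).indicator (fun y ↦ Real.cosh (y / 2))) / (a + Real.sinh a))
          * (primeShiftForm a ((Icc (-a) a).indicator (fun y ↦ Real.cosh (y / 2))) / (a + Real.sinh a))) atTop
      (𝓝 (∑' ρ : ZetaZeros.riemannZetaNontrivialZeros,
        (riemannZetaZeroOrder (ρ : ℂ) : ℝ) * ((riemannZetaZeroOrder (ρ : ℂ) : ℝ) / ‖(ρ : ℂ)‖ ^ 2))) := by
  set β := ∑' ρ : ZetaZeros.riemannZetaNontrivialZeros,
    (riemannZetaZeroOrder (ρ : ℂ) : ℝ) * ((riemannZetaZeroOrder (ρ : ℂ) : ℝ) / ‖(ρ : ℂ)‖ ^ 2) with hβdef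
  have hβ0 : 0 ≤ β := tsum_nonneg fun ρ ↦ by
    have := riemannZetaZeroOrder_nonneg (ZetaZeros.riemannZetaNontrivialZeros.ne_one ρ.2)
    have hm : (0 : ℝ) ≤ riemannZetaZeroOrder (ρ : ℂ) := by exact_mod_cast this
    positivity
  set w : ℝ → ℝ := fun a ↦
    (farCoercivityFloor a - primeShiftForm a ((Icc (-a) a).indicator (fun y ↦ Real.cosh (y / 2))) / (a + Real.sinh a))
      * (primeShiftForm a ((Icc (-a) a).indicator (fun y ↦ Real.cosh (y / 2))) / (a + Real.sinh a)) with hw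
  set Φ : ℝ → ℝ := fun b ↦ ∫ u in (0 : ℝ)..(2 * b), (Real.exp (-(u / 2)) * (ψ (Real.exp u) - Real.exp u)
      + Real.exp (-((2 * b - u) / 2)) * (ψ (Real.exp (2 * b - u)) - Real.exp (2 * b - u))) ^ 2 with hΦ
  -- the Cesàro mean of Φ and the integrability of Φ on [1, A]
  have hΦces : Tendsto (fun A : ℝ ↦ 1 / A ^ 2 * ∫ b in (1 : ℝ)..A, Φ b) atTop (𝓝 (2 * β)) :=
    tendsto_cesaro_cramerLagEnergy_of_RH hRH
  obtain ⟨CG, hCG⟩ := exists_abs_integral_cramerFn_le_of_RH hRH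
  have hX := fun (A : ℝ) (hA : 1 ≤ A) ↦ abs_integral_cross_le_of_primitive_bound hCG hA
  have hΦint : ∀ A : ℝ, 1 ≤ A → IntervalIntegrable Φ volume 1 A := by
    intro A hA
    have hmF2 : Monotone (fun b : ℝ ↦ ∫ u in (0 : ℝ)..(2 * b), Real.exp (-u) * (ψ (Real.exp u) - Real.exp u) ^ 2) :=
      fun x y hxy ↦ monotone_cramerMeanSq (by linarith)
    have hF2 : IntervalIntegrable (fun b : ℝ ↦ 2 * (∫ u in (0 : ℝ)..(2 * b), Real.exp (-u) * (ψ (Real.exp u) - Real.exp u) ^ 2))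
        volume 1 A := (hmF2.intervalIntegrable (a := 1) (b := A)).const_mul 2
    have hX2 := (hX A hA).1.const_mul 2
    refine (hF2.add hX2).congr fun b hb ↦ ?_
    rw [uIoc_of_le hA] at hb
    exact (cramerLagEnergy_eq (b := b) (by linarith [hb.1])).symm
  -- order characterisation of the limit
  rw [tendsto_order]
  constructor
  · -- lower: for l < β, eventually l < Ces_w
    intro l hl
    set η := β - l with hη
    have hη0 : 0 < η := by rw [hη]; linarith
    set ε := min (η / (8 * (β + 1))) 1 with hε
    have hε0 : 0 < ε := lt_min (by positivity) one_pos
    have hε1 : ε ≤ 1 := min_le_right _ _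
    have hεη : ε ≤ η / (8 * (β + 1)) := min_le_left _ _
    obtain ⟨K, a₁, hK0, ha₁1, hsand⟩ := abs_gapEnergy_sub_half_cramerLagEnergy_le_of_RH hRH hε0 hε0
    set ϑ := ε * (1 + ε) + ε with hϑ
    have hϑ1 : ϑ ≤ 3 * ε := by nlinarith
    have hϑ0 : 0 ≤ ϑ := by positivity
    have hϑβ : ϑ * β < η / 2 := by
      have h1 : ϑ * β ≤ 3 * ε * β := mul_le_mul_of_nonneg_right hϑ1 hβ0
      have h2 : ε * (8 * (β + 1)) ≤ η := by
        have := mul_le_mul_of_nonneg_right hεη (by positivity : (0 : ℝ) ≤ 8 * (β + 1))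
        rwa [div_mul_cancel₀ _ (by positivity)] at this
      nlinarith
    -- the minorant L(A) = (1−ϑ)/2·CesΦ(A) + c/A² − K/A → (1−ϑ)β > l
    set hw₁ := ∫ a in (1 : ℝ)..a₁, w a with hhw
    set hΦ₁ := ∫ b in (1 : ℝ)..a₁, Φ b with hhΦ
    set c := hw₁ - (1 - ϑ) / 2 * hΦ₁ + K * a₁ with hc
    have hL : Tendsto (fun A : ℝ ↦ (1 - ϑ) / 2 * (1 / A ^ 2 * ∫ b in (1 : ℝ)..A, Φ b) + c * (1 / A ^ 2) - K * A⁻¹) atTop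
        (𝓝 ((1 - ϑ) / 2 * (2 * β) + c * 0 - K * 0)) := by
      have h2 : Tendsto (fun A : ℝ ↦ 1 / A ^ 2) atTop (𝓝 0) := by
        have := (tendsto_inv_atTop_zero (𝕜 := ℝ)).comp (tendsto_pow_atTop (n := 2) two_ne_zero)
        rw [Function.comp_def] at this
        simpa [one_div] using this
      exact ((hΦces.const_mul _).add (h2.const_mul c)).sub (tendsto_inv_atTop_zero.const_mul K)
    have hlim : l < (1 - ϑ) / 2 * (2 * β) + c * 0 - K * 0 := by
      have : (1 - ϑ) / 2 * (2 * β) + c * 0 - K * 0 = β - ϑ * β := by ring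
      rw [this]; linarith
    have hev := hL.eventually_const_lt hlim
    filter_upwards [hev, eventually_ge_atTop a₁] with A hA hAa
    have hA1 : 1 ≤ A := ha₁1.trans hAa
    have hA0 : 0 < A := by linarith
    have hwint := intervalIntegrable_gapEnergy A hA1
    have hwint₁ := intervalIntegrable_gapEnergy a₁ ha₁1
    have hΦA := hΦint A hA1
    have hΦ₁' := hΦint a₁ ha₁1
    -- split at a₁
    have hws : ∫ a in (1 : ℝ)..A, w a = hw₁ + ∫ a in a₁..A, w a :=
      (intervalIntegral.integral_add_adjacent_intervals hwint₁ (hwint₁.symm.trans hwint)).symm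
    have hΦs : ∫ b in (1 : ℝ)..A, Φ b = hΦ₁ + ∫ b in a₁..A, Φ b :=
      (intervalIntegral.integral_add_adjacent_intervals hΦ₁' (hΦ₁'.symm.trans hΦA)).symm
    have hwtail : IntervalIntegrable w volume a₁ A := hwint₁.symm.trans hwint
    have hΦtail : IntervalIntegrable Φ volume a₁ A := hΦ₁'.symm.trans hΦA
    -- lower bound on the tail
    have iΦϑ : IntervalIntegrable (fun a ↦ (1 - ϑ) * (Φ a / 2)) volume a₁ A :=
      (hΦtail.const_mul ((1 - ϑ) / 2)).congr fun a _ ↦ by ring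
    have iL : IntervalIntegrable (fun a ↦ (1 - ϑ) * (Φ a / 2) - K) volume a₁ A := iΦϑ.sub intervalIntegrable_const
    have hlow : ∫ a in a₁..A, ((1 - ϑ) * (Φ a / 2) - K) ≤ ∫ a in a₁..A, w a :=
      intervalIntegral.integral_mono_on hAa iL hwtail fun a ha ↦ by
        have h := (abs_le.1 (hsand a ha.1)).1
        simp only [hw, hΦ]
        linarith
    have heval : ∫ a in a₁..A, ((1 - ϑ) * (Φ a / 2) - K) = (1 - ϑ) / 2 * (∫ b in a₁..A, Φ b) - K * (A - a₁) := by
      rw [intervalIntegral.integral_sub iΦϑ intervalIntegrable_const, intervalIntegral.integral_const, smul_eq_mul]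
      have : ∫ a in a₁..A, (1 - ϑ) * (Φ a / 2) = (1 - ϑ) / 2 * ∫ a in a₁..A, Φ a := by
        rw [← intervalIntegral.integral_const_mul]; congr 1; funext a; ring
      rw [this]; ring
    -- conclude: L(A) ≤ Ces_w(A)
    have hA2 : 0 < A ^ 2 := by positivity
    have hAne : A ≠ 0 := hA0.ne'
    have key : (1 - ϑ) / 2 * (1 / A ^ 2 * ∫ b in (1 : ℝ)..A, Φ b) + c * (1 / A ^ 2) - K * A⁻¹
        ≤ 1 / A ^ 2 * ∫ a in (1 : ℝ)..A, w a := by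
      rw [hws, hΦs]
      have e1 : (1 - ϑ) / 2 * (1 / A ^ 2 * (hΦ₁ + ∫ b in a₁..A, Φ b)) + c * (1 / A ^ 2) - K * A⁻¹
          = 1 / A ^ 2 * (hw₁ + ((1 - ϑ) / 2 * (∫ b in a₁..A, Φ b) - K * (A - a₁))) + K * (1 / A ^ 2 * A - A⁻¹) := by
        rw [hc]; ring
      have e2 : 1 / A ^ 2 * A - A⁻¹ = 0 := by field_simp; ring
      rw [e1, e2, mul_zero, add_zero]
      exact mul_le_mul_of_nonneg_left (by linarith [hlow, heval]) (by positivity)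
    exact lt_of_lt_of_le hA key
  · -- upper: for u > β, eventually Ces_w < u
    intro u hu
    set η := u - β with hη
    have hη0 : 0 < η := by rw [hη]; linarith
    set ε := min (η / (8 * (β + 1))) 1 with hε
    have hε0 : 0 < ε := lt_min (by positivity) one_pos
    have hε1 : ε ≤ 1 := min_le_right _ _
    have hεη : ε ≤ η / (8 * (β + 1)) := min_le_left _ _
    obtain ⟨K, a₁, hK0, ha₁1, hsand⟩ := abs_gapEnergy_sub_half_cramerLagEnergy_le_of_RH hRH hε0 hε0
    set ϑ := ε * (1 + ε) + ε with hϑ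
    have hϑ1 : ϑ ≤ 3 * ε := by nlinarith
    have hϑ0 : 0 ≤ ϑ := by positivity
    have hϑβ : ϑ * β < η / 2 := by
      have h1 : ϑ * β ≤ 3 * ε * β := mul_le_mul_of_nonneg_right hϑ1 hβ0
      have h2 : ε * (8 * (β + 1)) ≤ η := by
        have := mul_le_mul_of_nonneg_right hεη (by positivity : (0 : ℝ) ≤ 8 * (β + 1))
        rwa [div_mul_cancel₀ _ (by positivity)] at this
      nlinarith
    set hw₁ := ∫ a in (1 : ℝ)..a₁, w a with hhw
    set hΦ₁ := ∫ b in (1 : ℝ)..a₁, Φ b with hhΦ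
    set c := hw₁ - (1 + ϑ) / 2 * hΦ₁ - K * a₁ with hc
    have hU : Tendsto (fun A : ℝ ↦ (1 + ϑ) / 2 * (1 / A ^ 2 * ∫ b in (1 : ℝ)..A, Φ b) + c * (1 / A ^ 2) + K * A⁻¹) atTop
        (𝓝 ((1 + ϑ) / 2 * (2 * β) + c * 0 + K * 0)) := by
      have h2 : Tendsto (fun A : ℝ ↦ 1 / A ^ 2) atTop (𝓝 0) := by
        have := (tendsto_inv_atTop_zero (𝕜 := ℝ)).comp (tendsto_pow_atTop (n := 2) two_ne_zero)
        rw [Function.comp_def] at this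
        simpa [one_div] using this
      exact ((hΦces.const_mul _).add (h2.const_mul c)).add (tendsto_inv_atTop_zero.const_mul K)
    have hlim : (1 + ϑ) / 2 * (2 * β) + c * 0 + K * 0 < u := by
      have : (1 + ϑ) / 2 * (2 * β) + c * 0 + K * 0 = β + ϑ * β := by ring
      rw [this]; linarith
    have hev := hU.eventually_lt_const hlim
    filter_upwards [hev, eventually_ge_atTop a₁] with A hA hAa
    have hA1 : 1 ≤ A := ha₁1.trans hAa
    have hA0 : 0 < A := by linarith
    have hwint := intervalIntegrable_gapEnergy A hA1
    have hwint₁ := intervalIntegrable_gapEnergy a₁ ha₁1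
    have hΦA := hΦint A hA1
    have hΦ₁' := hΦint a₁ ha₁1
    have hws : ∫ a in (1 : ℝ)..A, w a = hw₁ + ∫ a in a₁..A, w a :=
      (intervalIntegral.integral_add_adjacent_intervals hwint₁ (hwint₁.symm.trans hwint)).symm
    have hΦs : ∫ b in (1 : ℝ)..A, Φ b = hΦ₁ + ∫ b in a₁..A, Φ b :=
      (intervalIntegral.integral_add_adjacent_intervals hΦ₁' (hΦ₁'.symm.trans hΦA)).symm
    have hwtail : IntervalIntegrable w volume a₁ A := hwint₁.symm.trans hwint
    have hΦtail : IntervalIntegrable Φ volume a₁ A := hΦ₁'.symm.trans hΦA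
    have iΦϑ : IntervalIntegrable (fun a ↦ (1 + ϑ) * (Φ a / 2)) volume a₁ A :=
      (hΦtail.const_mul ((1 + ϑ) / 2)).congr fun a _ ↦ by ring
    have iU : IntervalIntegrable (fun a ↦ (1 + ϑ) * (Φ a / 2) + K) volume a₁ A := iΦϑ.add intervalIntegrable_const
    have hup : ∫ a in a₁..A, w a ≤ ∫ a in a₁..A, ((1 + ϑ) * (Φ a / 2) + K) :=
      intervalIntegral.integral_mono_on hAa hwtail iU fun a ha ↦ by
        have h := (abs_le.1 (hsand a ha.1)).2
        simp only [hw, hΦ]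
        linarith
    have heval : ∫ a in a₁..A, ((1 + ϑ) * (Φ a / 2) + K) = (1 + ϑ) / 2 * (∫ b in a₁..A, Φ b) + K * (A - a₁) := by
      rw [intervalIntegral.integral_add iΦϑ intervalIntegrable_const, intervalIntegral.integral_const, smul_eq_mul]
      have : ∫ a in a₁..A, (1 + ϑ) * (Φ a / 2) = (1 + ϑ) / 2 * ∫ a in a₁..A, Φ a := by
        rw [← intervalIntegral.integral_const_mul]; congr 1; funext a; ring
      rw [this]; ring
    have hA2 : 0 < A ^ 2 := by positivity
    have hAne : A ≠ 0 := hA0.ne'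
    have key : 1 / A ^ 2 * (∫ a in (1 : ℝ)..A, w a)
        ≤ (1 + ϑ) / 2 * (1 / A ^ 2 * ∫ b in (1 : ℝ)..A, Φ b) + c * (1 / A ^ 2) + K * A⁻¹ := by
      rw [hws, hΦs]
      have e1 : (1 + ϑ) / 2 * (1 / A ^ 2 * (hΦ₁ + ∫ b in a₁..A, Φ b)) + c * (1 / A ^ 2) + K * A⁻¹
          = 1 / A ^ 2 * (hw₁ + ((1 + ϑ) / 2 * (∫ b in a₁..A, Φ b) + K * (A - a₁))) + K * (A⁻¹ - 1 / A ^ 2 * A) := by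
        rw [hc]; ring
      have e2 : A⁻¹ - 1 / A ^ 2 * A = 0 := by field_simp; ring
      rw [e1, e2, mul_zero, add_zero]
      exact mul_le_mul_of_nonneg_left (by linarith [hup, heval]) (by positivity)
    exact lt_of_le_of_lt key hA
end FloorResidualMean

end Summit.RiemannHypothesis.RiemannHypothesis.Theorems.WeilFormatC
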